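import Literature.Computability.AlgebraicComplexity.SingleProductExchange
import Literature.Computability.AlgebraicComplexity.SmallFormatRankProofs
import Literature.Computability.AlgebraicComplexity.LafonWinogradRankBound
import Literature.Computability.AlgebraicComplexity.SmallFormatMatMulRankUpper
import Literature.Computability.AlgebraicComplexity.SmallFormatMatMulRankUpperPart3
import Literature.Computability.AlgebraicComplexity.KroneckerRank
import HarnessLib

/-!
# One more row costs at least `m` products: `R(⟨c,m,n⟩) + m ≤ R(⟨c+1,m,n⟩)`, and the census
floors `28 ≤ R(⟨3,4,4⟩)`, `34 ≤ R(⟨3,4,5⟩)`, `46 ≤ R(⟨4,5,5⟩)` over every field (census cell, derived)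

Topic `Summits/MatrixMultiplication/OmegaCensus/SmallFormats` (cell pub-omega, family (a), the
any-field LOWER column of the small-format rank census `RankWindows.lean`). Framing: lottery
ticket; floor = certified bounds/negative ranges. This is a DERIVED cell, not a published statement
(hence under `Summits/`, per the placement rule): the only ingredient beyond the tree's published
theorems is the elementary substitution step below, and the three floors are what it yields from
Bläser's theorem `R(⟨n,m,n⟩) ≥ 2mn + 2n − m − 2` (Bläser 2003, Thm. 14, PROVED in the tree:
`blaser2003_thm14_holds`).

## The substitution step (Pan's substitution method for bilinear computations)

`tensorRank_matMulTensor_succ_row`: over every field `k`, for all `c, m` and `n ≥ 1`,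
`R(⟨c,m,n⟩) + m ≤ R(⟨c+1,m,n⟩)`. Proof (`RankRowIncrement.row_step`): let
`(f_i, g_i, w_i)_{i ∈ ι}` compute `(x, y) ↦ xy` on `k^{(c+1)×m} × k^{m×n}` (a `BilinComp`, Bläser
2003 Def. 1, tree). The forms `ξ ↦ f_i(ξ placed in the last row)` on `k^m` have no common zero
(conciseness, `BilinComp.eq_zero_of_forall_f`), so a subfamily `J` of them is a coordinate system
of `k^m` (`exists_subset_forall_exists_eq`); in particular `|J| ≥ m`. On the subspace
`U' = ⋂_{j ∈ J} ker f_j` the `|J|` products `j ∈ J` drop out (`BilinComp.restrictDrop`, Wang 2026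
Lemma 3 as formalised in `SingleProductExchange.lean`), and `U'` still projects ONTO the first `c`
rows: for every `x' ∈ k^{c×m}` the last row can be solved for. Composing a linear section of that
projection with "forget the last row of the product" exhibits `⟨c,m,n⟩` as a restriction of the
restricted map (`BilinComp.comap`), computed with `|ι| − |J| ≤ |ι| − m` products. The column form
`R(⟨c,m,n⟩) + m ≤ R(⟨c,m,n+1⟩)` (`c ≥ 1`) follows by transposition
(`tensorRank_matMulTensor_transpose`). (The border-rank analogue with `+1` in place of `+m` is
Lickteig's increment, `LickteigBorderSubstitution.lean`.)

## The three census floors (every field; universe `Type` as in `blaser2003_thm14`)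

* `twentyeight_le_tensorRank_matMulTensor_344`: `28 ≤ R(⟨3,4,4⟩)` — from `R(⟨3,4,3⟩) ≥ 24`
  (Thm. 14 at `m = 4, n = 3`) plus one column (`+4`). Window `[28, 38]` (was `[27, 38]` by
  Lafon–Winograd).
* `thirtyfour_le_tensorRank_matMulTensor_345`: `34 ≤ R(⟨3,4,5⟩)` — from `R(⟨3,5,3⟩) ≥ 29`
  (Thm. 14 at `m = 5, n = 3`) plus one column (`+5`) and `R(⟨3,5,4⟩) = R(⟨3,4,5⟩)`. Window
  `[34, 47]` (was `[33, 47]`).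
* `fortysix_le_tensorRank_matMulTensor_455`: `46 ≤ R(⟨4,5,5⟩)` — from `R(⟨4,5,4⟩) ≥ 41` (Thm. 14
  at `m = 5, n = 4`) plus one column (`+5`). Window `[46, 76]` (was `[44, 76]`).

These three numbers coincide with the values of Bläser's earlier bound
`R(⟨c,m,n⟩) ≥ cm + mn + c − m + n − 3` (`n ≥ c ≥ 2`; M. Bläser, Comput. Complexity 8 (1999)
203–226, as quoted in Bläser 2003, eq. (1) p. 45 — NOT in the tree, source paywalled, acq-09190)
on these three formats; they do NOT reach that bound on `⟨3,5,5⟩` (here `39`, print `40`), which is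
why this file makes no claim about the 1999 theorem itself. HONEST FRAMING: nothing here is new
mathematics; the value is that three 'bound reached (a)' floors of the census table are now kernel
theorems at the level printed in the literature instead of one or two below it.

## References

* M. Bläser, *On the complexity of the multiplication of matrices of small formats*,
  J. Complexity 19 (2003) 43–60: Def. 1, §3, Thm. 14, eq. (1). [Blaser2003]
* C. Wang, *Automated Lower Bounds for Bilinear Complexity over Finite Fields*, arXiv:2603.07280
  (2026), Lemma 3 (the substitution step `restrictDrop`). [Wang2026]
* P. Bürgisser, M. Clausen, M. A. Shokrollahi, *Algebraic Complexity Theory* (1997), Ch. 6 (the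
  substitution method), Thm. (17.12), Rem. (17.13)(3). [BurgisserClausenShokrollahi1997]
-/

noncomputable section

open scoped BigOperators

namespace Summit.MatrixMultiplication.OmegaCensus

open Literature.Computability.AlgebraicComplexity Module Matrix

namespace RankRowIncrement

variable {k : Type*} [Field k]

/-! ## A computation of `⟨c,m,n⟩` bounds the rank by its length -/

section ToRank

variable {c m n : ℕ} {ι : Type*} [Fintype ι]

/-- A bilinear computation `(f_i, g_i, w_i)_{i ∈ ι}` of `(x, y) ↦ xy` on `k^{c×m} × k^{m×n}` is a
decomposition of `⟨c,m,n⟩` into `|ι|` triads (`u_i = (f_i(E_b))_b`, `v_i = (g_i(E_q))_q`, `w_i`),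
so `R(⟨c,m,n⟩) ≤ |ι|` (rank = bilinear complexity, Bläser 2003 Def. 1 / Bläser 2013 Def. 4.4–4.5;
the converse bridge is `exists_bilinComp_of_tensorRank_le`). [cite: Blaser2003, Def. 1] -/
theorem tensorRank_le_card (β : BilinComp (mulBilin k c m n) ι) :
    tensorRank (matMulTensor k c m n) ≤ Fintype.card ι := by
  classical
  refine tensorRank_le_card_of_eq_sum
    (fun i (a : Fin c × Fin n) => β.w i a.1 a.2)
    (fun i (b : Fin c × Fin m) => β.f i (Matrix.single b.1 b.2 1))
    (fun i (q : Fin m × Fin n) => β.g i (Matrix.single q.1 q.2 1)) ?_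
  funext a b q
  have h := β.map_eq_sum (Matrix.single b.1 b.2 (1 : k)) (Matrix.single q.1 q.2 (1 : k))
  rw [mulBilin_apply] at h
  have h' := congrFun (congrFun h a.1) a.2
  rw [Matrix.sum_apply] at h'
  simp only [Matrix.smul_apply, smul_eq_mul] at h'
  have lhs : (Matrix.single b.1 b.2 (1 : k) * Matrix.single q.1 q.2 (1 : k)) a.1 a.2 =
      matMulTensor k c m n a b q := by
    simp only [matMulTensor]
    by_cases hbq : b.2 = q.1
    · rw [hbq, Matrix.single_mul_single_same, mul_one, Matrix.single_apply]
      by_cases h1 : a.1 = b.1 <;> by_cases h2 : a.2 = q.2 <;> simp [h1, h2, eq_comm]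
    · rw [Matrix.single_mul_single_of_ne (h := hbq), Matrix.zero_apply]
      simp [hbq]
  rw [← lhs, h']
  simp only [Finset.sum_apply, triad_apply]
  refine Finset.sum_congr rfl fun i _ => ?_
  ring

end ToRank

/-! ## Rows: padding, the last row, forgetting the last row -/

section Rows

variable (k)

/-- `x' ↦ [x'; 0]`: a `c × h` matrix padded by a zero last row. [folklore] -/
def padTop (c h : ℕ) : Matrix (Fin c) (Fin h) k →ₗ[k] Matrix (Fin (c + 1)) (Fin h) k where
  toFun x' := Matrix.of (Fin.snoc (fun i => x' i) (0 : Fin h → k))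
  map_add' x y := by
    ext i j
    refine Fin.lastCases ?_ (fun i => ?_) i
    · simp [Fin.snoc_last]
    · simp [Fin.snoc_castSucc]
  map_smul' a x := by
    ext i j
    refine Fin.lastCases ?_ (fun i => ?_) i
    · simp [Fin.snoc_last]
    · simp [Fin.snoc_castSucc]

/-- `ξ ↦ [0; ξ]`: the vector `ξ ∈ k^h` placed in the last row of an otherwise zero
`(c+1) × h` matrix. [folklore] -/
def lastRow (c h : ℕ) : (Fin h → k) →ₗ[k] Matrix (Fin (c + 1)) (Fin h) k where
  toFun ξ := Matrix.of (Fin.snoc (fun _ : Fin c => (0 : Fin h → k)) ξ)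
  map_add' x y := by
    ext i j
    refine Fin.lastCases ?_ (fun i => ?_) i
    · simp [Fin.snoc_last]
    · simp [Fin.snoc_castSucc]
  map_smul' a x := by
    ext i j
    refine Fin.lastCases ?_ (fun i => ?_) i
    · simp [Fin.snoc_last]
    · simp [Fin.snoc_castSucc]

/-- `x ↦` its first `c` rows (forget the last row of a `(c+1) × h` matrix). [folklore] -/
def topRows (c h : ℕ) : Matrix (Fin (c + 1)) (Fin h) k →ₗ[k] Matrix (Fin c) (Fin h) k where
  toFun x := Matrix.of fun i j => x i.castSucc j
  map_add' x y := by ext i j; simp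
  map_smul' a x := by ext i j; simp

variable {k}

/-- Entries of `[x'; 0]` in the first `c` rows. [folklore] -/
@[simp] theorem padTop_apply_castSucc {c h : ℕ} (x' : Matrix (Fin c) (Fin h) k) (i : Fin c)
    (j : Fin h) : padTop k c h x' i.castSucc j = x' i j := by
  simp [padTop, Fin.snoc_castSucc]

/-- The last row of `[x'; 0]` vanishes. [folklore] -/
@[simp] theorem padTop_apply_last {c h : ℕ} (x' : Matrix (Fin c) (Fin h) k) (j : Fin h) :
    padTop k c h x' (Fin.last c) j = 0 := by
  simp [padTop, Fin.snoc_last]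

/-- The first `c` rows of `[0; ξ]` vanish. [folklore] -/
@[simp] theorem lastRow_apply_castSucc {c h : ℕ} (ξ : Fin h → k) (i : Fin c) (j : Fin h) :
    lastRow k c h ξ i.castSucc j = 0 := by
  simp [lastRow, Fin.snoc_castSucc]

/-- The last row of `[0; ξ]` is `ξ`. [folklore] -/
@[simp] theorem lastRow_apply_last {c h : ℕ} (ξ : Fin h → k) (j : Fin h) :
    lastRow k c h ξ (Fin.last c) j = ξ j := by
  simp [lastRow, Fin.snoc_last]

/-- Entries of the first `c` rows. [folklore] -/
@[simp] theorem topRows_apply {c h : ℕ} (x : Matrix (Fin (c + 1)) (Fin h) k) (i : Fin c)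
    (j : Fin h) : topRows k c h x i j = x i.castSucc j := rfl

/-- The last-row embedding is injective. [folklore] -/
theorem lastRow_injective (c h : ℕ) : Function.Injective (lastRow k c h) := by
  intro ξ ξ' hξ
  funext j
  have := congrFun (congrFun hξ (Fin.last c)) j
  simpa using this

/-- Forgetting the last row of `[x'; 0] + [0; ξ]` gives back `x'`. [folklore] -/
theorem topRows_padTop_add_lastRow {c h : ℕ} (x' : Matrix (Fin c) (Fin h) k) (ξ : Fin h → k) :
    topRows k c h (padTop k c h x' + lastRow k c h ξ) = x' := by
  ext i j
  simp

/-- The first `c` rows of a product are the product of the first `c` rows. [folklore] -/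
theorem topRows_mul {c m n : ℕ} (x : Matrix (Fin (c + 1)) (Fin m) k)
    (y : Matrix (Fin m) (Fin n) k) : topRows k c n (x * y) = topRows k c m x * y := by
  ext i j
  simp [Matrix.mul_apply]

end Rows

/-! ## The substitution step -/

section Step

variable {c m n : ℕ} {ι : Type*} [Fintype ι]

/-- **The substitution step.** Every bilinear computation of `⟨c+1,m,n⟩` (`n ≥ 1`) has at least
`R(⟨c,m,n⟩) + m` products: a coordinate system `J` (`|J| ≥ m`) among the last-row forms is
killed by restricting to `U' = ⋂_{j∈J} ker f_j`, which still projects onto the first `c` rows, and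
forgetting the last row of the product leaves a computation of `⟨c,m,n⟩`. [folklore] -/
theorem row_step (hn : 0 < n) (β : BilinComp (mulBilin k (c + 1) m n) ι) :
    tensorRank (matMulTensor k c m n) + m ≤ Fintype.card ι := by
  classical
  -- the forms on the last row
  let φ : ι → Module.Dual k (Fin m → k) := fun i => (β.f i).comp (lastRow k c m)
  have hφ : ∀ ξ ∈ (⊤ : Submodule k (Fin m → k)),
      (∀ j ∈ (Finset.univ : Finset ι), φ j ξ = 0) → ξ = 0 := by
    intro ξ _ h0
    have hz : lastRow k c m ξ = 0 :=
      β.eq_zero_of_forall_f hn _ fun i => by simpa [φ] using h0 i (Finset.mem_univ i)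
    exact lastRow_injective c m (by rw [hz, map_zero])
  obtain ⟨J, -, hJinj, hJsurj⟩ := BilinComp.exists_subset_forall_exists_eq ⊤ Finset.univ φ hφ
  -- `|J| ≥ m`
  have hJcard : m ≤ J.card := by
    have h := BilinComp.finrank_le_card_of_forall_eq_zero (⊤ : Submodule k (Fin m → k)) J φ hJinj
    rwa [finrank_top, Module.finrank_fin_fun] at h
  -- the subspace `U' = ⋂_{j ∈ J} ker f_j`
  let U' : Submodule k (Matrix (Fin (c + 1)) (Fin m) k) := ⨅ j ∈ J, LinearMap.ker (β.f j)
  have hU' : ∀ j ∈ J, ∀ u ∈ U', β.f j u = 0 := by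
    intro j hj u hu
    have h1 := (Submodule.mem_iInf _).1 hu j
    have h2 := (Submodule.mem_iInf _).1 h1 hj
    exact h2
  -- `U'` projects onto the first `c` rows
  let T : U' →ₗ[k] Matrix (Fin c) (Fin m) k := (topRows k c m).comp U'.subtype
  have hT : Function.Surjective T := by
    intro x'
    obtain ⟨ξ, -, hξ⟩ := hJsurj fun j => -β.f j (padTop k c m x')
    have hmem : padTop k c m x' + lastRow k c m ξ ∈ U' := by
      refine (Submodule.mem_iInf _).2 fun j => (Submodule.mem_iInf _).2 fun hj => ?_
      rw [LinearMap.mem_ker, map_add]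
      have h1 : β.f j (lastRow k c m ξ) = -β.f j (padTop k c m x') := by
        simpa [φ] using hξ j hj
      rw [h1, add_neg_cancel]
    exact ⟨⟨_, hmem⟩, topRows_padTop_add_lastRow x' ξ⟩
  obtain ⟨g, hg⟩ := T.exists_rightInverse_of_surjective (LinearMap.range_eq_top.2 hT)
  have hg' : ∀ x', topRows k c m ((g x' : U') : Matrix (Fin (c + 1)) (Fin m) k) = x' := by
    intro x'
    have := LinearMap.congr_fun hg x'
    simpa [T] using this
  -- restrict to `U'`, drop the products `j ∈ J`, forget the last row of the product
  let β₁ := β.restrictDrop U' J hU'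
  let β₂ : BilinComp (mulBilin k c m n) {i // i ∉ J} :=
    β₁.comap g LinearMap.id (topRows k c n) (fun x' y => by
      simp only [LinearMap.comp_apply, Submodule.subtype_apply, mulBilin_apply,
        LinearMap.id_apply]
      rw [topRows_mul, hg'])
  have h1 := tensorRank_le_card β₂
  rw [BilinComp.card_restrictDrop_index] at h1
  have h2 : J.card ≤ Fintype.card ι := Finset.card_le_univ J
  omega

end Step

/-! ## The increment theorems -/

/-- **One more row costs at least `m` products**: over every field, for `n ≥ 1`,
`R(⟨c,m,n⟩) + m ≤ R(⟨c+1,m,n⟩)`. [folklore] -/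
theorem tensorRank_matMulTensor_succ_row (k : Type*) [Field k] (c m n : ℕ) (hn : 0 < n) :
    tensorRank (matMulTensor k c m n) + m ≤ tensorRank (matMulTensor k (c + 1) m n) := by
  obtain ⟨β⟩ := exists_bilinComp_of_tensorRank_le (k := k) (c := c + 1) (m := m) (n := n) le_rfl
  simpa using row_step hn β

/-- **One more column costs at least `m` products**: over every field, for `c ≥ 1`,
`R(⟨c,m,n⟩) + m ≤ R(⟨c,m,n+1⟩)` (transpose of the row form). [folklore] -/
theorem tensorRank_matMulTensor_succ_col (k : Type*) [Field k] (c m n : ℕ) (hc : 0 < c) :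
    tensorRank (matMulTensor k c m n) + m ≤ tensorRank (matMulTensor k c m (n + 1)) := by
  rw [tensorRank_matMulTensor_transpose k c m n, tensorRank_matMulTensor_transpose k c m (n + 1)]
  exact tensorRank_matMulTensor_succ_row k n m c hc

/-- `d` more rows cost at least `d·m` products: `R(⟨c,m,n⟩) + d m ≤ R(⟨c+d,m,n⟩)` (`n ≥ 1`).
[folklore] -/
theorem tensorRank_matMulTensor_add_rows (k : Type*) [Field k] (c m n d : ℕ) (hn : 0 < n) :
    tensorRank (matMulTensor k c m n) + d * m ≤ tensorRank (matMulTensor k (c + d) m n) := by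
  induction d with
  | zero => simp
  | succ d ih =>
    have h := tensorRank_matMulTensor_succ_row k (c + d) m n hn
    rw [Nat.succ_mul, ← Nat.add_assoc c d 1]
    omega

/-- `d` more columns cost at least `d·m` products: `R(⟨c,m,n⟩) + d m ≤ R(⟨c,m,n+d⟩)` (`c ≥ 1`).
[folklore] -/
theorem tensorRank_matMulTensor_add_cols (k : Type*) [Field k] (c m n d : ℕ) (hc : 0 < c) :
    tensorRank (matMulTensor k c m n) + d * m ≤ tensorRank (matMulTensor k c m (n + d)) := by
  induction d with
  | zero => simp
  | succ d ih =>
    have h := tensorRank_matMulTensor_succ_col k c m (n + d) hc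
    rw [Nat.succ_mul, ← Nat.add_assoc n d 1]
    omega

/-- **Bläser 2003, Thm. 14 plus extra columns**: for `m ≥ n ≥ 3` and every `d`,
`2mn + 2n − m − 2 + d m ≤ R(⟨n, m, n + d⟩)` over every field. [cite: Blaser2003, Theorem 14] -/
theorem blaser2003_thm14_add_cols (K : Type) [Field K] (m n d : ℕ) (hn : 3 ≤ n) (hnm : n ≤ m) :
    2 * m * n + 2 * n - m - 2 + d * m ≤ tensorRank (matMulTensor K n m (n + d)) := by
  have h14 := blaser2003_thm14_holds K m n hn hnm
  have h := tensorRank_matMulTensor_add_cols K n m n d (by omega)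
  omega

/-! ## The three census floors -/

section Cells

variable (K : Type) [Field K]

/-- **`28 ≤ R(⟨3,4,4⟩)` over every field** (`R(⟨3,4,3⟩) ≥ 24`, Bläser 2003 Thm. 14 at
`m = 4, n = 3`, plus one column). Census window `⟨3,4,4⟩`: `[28, 38]`.
[cite: Blaser2003, Theorem 14] -/
theorem twentyeight_le_tensorRank_matMulTensor_344 : 28 ≤ tensorRank (matMulTensor K 3 4 4) := by
  have h := blaser2003_thm14_add_cols K 4 3 1 le_rfl (by norm_num)
  simpa using h

/-- **`34 ≤ R(⟨3,4,5⟩)` over every field** (`R(⟨3,5,3⟩) ≥ 29`, Bläser 2003 Thm. 14 at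
`m = 5, n = 3`, plus one column, and `R(⟨3,5,4⟩) = R(⟨3,4,5⟩)`). Census window `⟨3,4,5⟩`:
`[34, 47]`. [cite: Blaser2003, Theorem 14] -/
theorem thirtyfour_le_tensorRank_matMulTensor_345 : 34 ≤ tensorRank (matMulTensor K 3 4 5) := by
  have h := blaser2003_thm14_add_cols K 5 3 1 le_rfl (by norm_num)
  rw [tensorRank_matMulTensor_rotate K 3 4 5, tensorRank_matMulTensor_transpose K 4 5 3]
  simpa using h

/-- **`46 ≤ R(⟨4,5,5⟩)` over every field** (`R(⟨4,5,4⟩) ≥ 41`, Bläser 2003 Thm. 14 at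
`m = 5, n = 4`, plus one column). Census window `⟨4,5,5⟩`: `[46, 76]`.
[cite: Blaser2003, Theorem 14] -/
theorem fortysix_le_tensorRank_matMulTensor_455 : 46 ≤ tensorRank (matMulTensor K 4 5 5) := by
  have h := blaser2003_thm14_add_cols K 5 4 1 (by norm_num) (by norm_num)
  simpa using h

/-- The three sharpened windows in the format of `RankWindows.lean` (upper ends: Smirnov 2013
`⟨3,4,4⟩ ≤ 38`, AlphaTensor `⟨3,4,5⟩ ≤ 47`, `⟨4,5,5⟩ ≤ 76`, kernel-checked schemes in the tree).
[cite: Blaser2003, Theorem 14] -/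
theorem window_344 : tensorRank (matMulTensor K 3 4 4) ∈ Set.Icc 28 38 :=
  ⟨twentyeight_le_tensorRank_matMulTensor_344 K, tensorRank_matMulTensor_344_le K⟩

/-- See `window_344`. [cite: Blaser2003, Theorem 14] -/
theorem window_345 : tensorRank (matMulTensor K 3 4 5) ∈ Set.Icc 34 47 :=
  ⟨thirtyfour_le_tensorRank_matMulTensor_345 K, tensorRank_matMulTensor_345_le K⟩

/-- See `window_344`. [cite: Blaser2003, Theorem 14] -/
theorem window_455 : tensorRank (matMulTensor K 4 5 5) ∈ Set.Icc 46 76 :=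
  ⟨fortysix_le_tensorRank_matMulTensor_455 K, tensorRank_matMulTensor_455_le K⟩

end Cells

end RankRowIncrement

end Summit.MatrixMultiplication.OmegaCensus

end
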